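import Summits.MatrixMultiplication.OmegaCensus.ThreeSetLineCertificate
import HarnessLib

/-!
# A divisibility obstruction for the three-set line identity (the `(2,2)` and `(4)` W-data, every `p`)

ω-census `pub-omega`, family (b3), seat pub-omega-group gen 39.  Framing: lottery ticket; floor = certified bounds/negative
ranges.  VALUE: the one PROVABLE-FOR-ALL-`p` case of the 'line lemma' behind the W-level route for three-set cube cells over `ℤ_p²`
(`RESULTS-g39 §5`): NOT progress on ω.

If every entry of the `W`-datum is divisible by `m` and `m ∤ K`, the three-set line identity
`Σ_u M_{W,F}(τ,u)·G(u) + [s = τ] = K` (`lineMat3`) has no solution as soon as there is a `τ ≠ s` (i.e. `q ≥ 2`): every `M(τ,u)` is a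
multiple of `m`.  In the census (`K = p` odd) this kills the `W`-line data of types `(2,2)` and `(4)` — a frame `{0, e₁, e₂, c}` with
`c` on the line `u₁ + u₂ = 0` or `= 1`, resp. never — for EVERY prime `p`, with no computation.
-/

namespace Summit.MatrixMultiplication.OmegaCensus

open Finset

namespace LineInv

variable {q : ℕ} [NeZero q]

/-- `m` divides every entry of the three-set line matrix when it divides every entry of the `W`-datum. [folklore] -/
theorem dvd_lineMat3_of_dvd {m : ℕ} {W : ZMod q → ℕ} (hW : ∀ v, m ∣ W v) (F : ZMod q → ℕ) (τ u : ZMod q) :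
    m ∣ lineMat3 W F τ u := by
  unfold lineMat3
  exact Finset.dvd_sum fun v _ => Dvd.dvd.mul_right (hW v) _

/-- **Divisibility obstruction.**  If `m` divides every `W(v)`, `m ∤ K`, and some `τ ≠ s` exists, then no `F, G` satisfy the three-set
line identity with hole `s` and constant `K`. [folklore] -/
theorem no_line_identity3_of_dvd {m K : ℕ} {W : ZMod q → ℕ} (hW : ∀ v, m ∣ W v) (hK : ¬ m ∣ K) (F G : ZMod q → ℕ)
    (s τ₀ : ZMod q) (hτ₀ : τ₀ ≠ s)
    (hid : ∀ τ : ZMod q, (∑ u : ZMod q, lineMat3 W F τ u * G u) + (if s = τ then 1 else 0) = K) : False := by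
  have h0 := hid τ₀
  rw [if_neg (Ne.symm hτ₀), add_zero] at h0
  apply hK
  rw [← h0]
  exact Finset.dvd_sum fun u _ => Dvd.dvd.mul_right (dvd_lineMat3_of_dvd hW F τ₀ u) _

/-- **The `(2,2)` / `(4)` W-data at odd `K`**: a `W`-datum with all entries even admits no solution of the three-set line identity
with odd constant `K` over `ℤ_q`, `q ≥ 2`. [folklore] -/
theorem no_line_identity3_of_even {K : ℕ} {W : ZMod q → ℕ} (hW : ∀ v, 2 ∣ W v) (hK : K % 2 = 1) (hq : 2 ≤ q)
    (F G : ZMod q → ℕ) (s : ZMod q)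
    (hid : ∀ τ : ZMod q, (∑ u : ZMod q, lineMat3 W F τ u * G u) + (if s = τ then 1 else 0) = K) : False := by
  have hK' : ¬ 2 ∣ K := by omega
  by_cases hs : s = 0
  · refine no_line_identity3_of_dvd hW hK' F G s 1 ?_ hid
    rw [hs]
    haveI : Fact (1 < q) := ⟨hq⟩
    exact one_ne_zero
  · exact no_line_identity3_of_dvd hW hK' F G s 0 (Ne.symm hs) hid

end LineInv

end Summit.MatrixMultiplication.OmegaCensus
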